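import Summits.BirchSwinnertonDyer.BirchSwinnertonDyer.Theorems.EisensteinPrimesWeakLeopoldtDescentAlgebra
import Summits.BirchSwinnertonDyer.BirchSwinnertonDyer.Theorems.EisensteinPrimesAcTwistDeformationShapiroH
import Summits.BirchSwinnertonDyer.BirchSwinnertonDyer.Theorems.EisensteinPrimesAcTwistDeformationCofreeRank
import Literature.NumberTheory.GaloisCohomology.PoitouTateRestrictedRamification
import Mathlib.RingTheory.PowerSeries.NoZeroDivisors
import HarnessLib

/-!
# Weak Leopoldt on the ANTICYCLOTOMIC line: `H²(Gal(K_Σ/K_∞), A) = 0` from `corank_Λ H²(K_Σ/K, 𝐃₁) = 0`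
# (V21 road input WL_A; cell `bsd-eis`, seat `bsd-line-x1-p1-w2` gen 4; crux 2 `GoodLatticeBDPValue`
# stmt-BirchSwinnertonDyer-19032, line `halves`)

HONEST FRAMING (cell `bsd-eis`, run/shared/lean/pub/bsd-eis/): theorems only (no definition, no named fact, no `sorry`,
no `Theses` import); the PUBLISHED facts `cd_p(G_{K,Σ}) ≤ 2` (Harari Cor. 17.14 / NSW (8.3.18),
`groupCdLE_two_galoisGroupUnramifiedOutside`) and Greenberg 2006 Prop. 3.2 (`prop32_cohomology_isCofinitelyGenerated`)
enter only as HYPOTHESES of the `_of_facts` variants; nothing about any curve is asserted; BSD / IMC2 / KY Thm. 1.4.1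
are proved for NO curve here. Helper `--supports stmt-BirchSwinnertonDyer-19032`; closes no registered stub.

## What (LEAD g4 memo `Cruxes/GoodLatticeBDPValue/Lines/halves-imprimLambda-index-road.md` §3, input WL_A)

Step (6) of the exact `λ`-identity (KY Thm. 1.4.1 (iii)) needs `H²(G, A_?) = 0` for `G = Gal(K_Σ/K_∞)`, `K_∞` the
anticyclotomic `ℤ_p`-extension, `A_? ∈ {E[p^∞], (F/𝒪)(θsub), (F/𝒪)(θquot)}`. The cell's `K`-side currency is the
one-variable twist deformation `𝐃₁ = bigRep (κ.liftUnramifiedOutside S hS) ρ₀` over `Λ = 𝒪⟦T⟧`, for which the corank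
squeeze (LEAD g2 `AcTwistDeformation.hasCorank_H1_one_and_H2_zero`, w3 g3 `…SURRank`) yields
`HasCorank Λ ((bigRep κ̄ ρ₀).H 2) 0`. THIS FILE assembles this seat's two previous files into the vanishing ABOVE:

* §1 `isPrimaryTorsion_bigRepModule`, `exists_zpow_smul_eq_zero_bigRepModule` (`𝐃₁` is `p`-primary, unconditionally);
  **`subsingleton_H_bigRep_of_hasCorank_zero`** (`K`-side: `cd_p(G_{K,Σ}) ≤ n`, `𝐃₁` cofree, `Hⁿ(K_Σ/K, 𝐃₁)`
  cofinitely generated of corank `0` ⟹ `Hⁿ(K_Σ/K, 𝐃₁) = 0`, by `…WeakLeopoldtDescentAlgebra`);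
  **`subsingleton_H_above_of_hasCorank_zero`** — the same hypotheses + `A` `p`-primary ⟹
  `Subsingleton ((ρ₀.restrict (galoisGroupAboveSubtype S κ.kerSubgroup)).H n)` = **`Hⁿ(Gal(K_Σ/K_∞), A) = 0`**
  (one-variable Shapiro `…AcTwistDeformationShapiroH`).
* §2 `…_of_facts`: the same with `cd` and cofinite generation DISCHARGED from the two PUB named facts (as hypotheses
  `hCD2 : groupCdLE_two_galoisGroupUnramifiedOutside K`, `h32 : prop32_cohomology_isCofinitelyGenerated`), for
  `Λ = ℤ_p⟦T⟧`, `S ⊇ {v ∣ p}` finite, `p ≠ 2`; what remains is `IsCofree Λ 𝐃₁` and `HasCorank Λ (H²(K_Σ/K, 𝐃₁)) 0`.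
* §3 the two coefficient shapes of the crux: `subsingleton_H_two_above_of_corank_one` (`A` of Pontryagin corank one,
  `ℤ_p ≅ Hom(A, ℚ/ℤ)` — the characters `(F/𝒪)(θ)`, cofreeness by LEAD g2's `isCofree_bigRepModule`) and
  `subsingleton_H_two_above_of_linearEquiv_pi` (`A ≃ₗ[ℤ_p] (ℚ_p/ℤ_p)ⁿ` — `E[p^∞]` with `n = 2`, cofreeness by w3 g3's
  `isCofree_bigRepModule_pi`): WL_A on the anticyclotomic line MODULO (CD2, Prop. 3.2, `corank H²(K_Σ/K, 𝐃₁) = 0`).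
* §4 currency bridge (`nonempty_H_restrict_addEquiv_of_continuousAddEquiv`, `subsingleton_H_restrict_iff_…`): the
  vanishing for `ρ₀|_{Gal(K_Σ/K_∞)}` transfers to ANY `G_{K,S}`-module continuously-additively isomorphic to `A` (any
  coefficient ring), e.g. the consumer's `E[p^∞]` / `(F/𝒪)(θ)` models (`ContinuousRep.HAddEquivOfContinuousAddEquiv`).

References: [Greenberg2006] Thm. 3 p. 342, Props. 3.2–3.6 pp. 358–360, Prop. 4.1 p. 367; [Greenberg2016Selmer] §2.2 p. 6
(LEO), §2.3 p. 7 (the corank squeeze); [NeukirchSchmidtWingberg2008] (8.3.18); [Harari2020] Cor. 17.14;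
[PollackWeston2011] proof of Prop. A.2; [KellerYin2024] §1.4 (arXiv:2402.12781v2); the road memo.
-/

set_option autoImplicit false
set_option linter.dupNamespace false -- the summit namespace `…BirchSwinnertonDyer.BirchSwinnertonDyer.Theorems` (Sub = Summit, D-0017) trips it

noncomputable section

open scoped Classical
open NumberField IsDedekindDomain Field
open Literature.NumberTheory.GaloisRepresentations Literature.NumberTheory.GaloisCohomology
open Literature.NumberTheory.EllipticCurves (ZpExtension BigRepModule bigRep)
open Literature.NumberTheory.IwasawaTheory Literature.NumberTheory.IwasawaTheory.Greenberg2016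
  Literature.NumberTheory.IwasawaTheory.Greenberg2006
open Summit.BirchSwinnertonDyer.BirchSwinnertonDyer.Theorems.WeakLeopoldtDescent
  Summit.BirchSwinnertonDyer.BirchSwinnertonDyer.Theorems.AcTwistDeformationShapiroH

namespace Summit.BirchSwinnertonDyer.BirchSwinnertonDyer.Theorems.WeakLeopoldtAbove

/-! ## §1 `Hⁿ(K_Σ/K, 𝐃₁) = 0` and `Hⁿ(K_Σ/K_∞, A) = 0` from corank `0`, `cd_p ≤ n` and cofreeness -/

section Generic

variable {K : Type} [Field K] [NumberField K] (S : Set (HeightOneSpectrum (𝓞 K))) {p : ℕ} [Fact p.Prime]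
  (hS : ∀ v : HeightOneSpectrum (𝓞 K), ((p : ℕ) : 𝓞 K) ∈ v.asIdeal → v ∈ S)
  (κ : ZpExtension K p)
  {𝒪 : Type} [CommRing 𝒪] [IsDomain 𝒪] [TopologicalSpace 𝒪] [TopologicalSpace (PowerSeries 𝒪)]
  {A : Type} [AddCommGroup A] [Module 𝒪 A] [TopologicalSpace A] [DiscreteTopology A] [ContinuousSMul 𝒪 A]
  [ContinuousSMul (PowerSeries 𝒪) (BigRepModule 𝒪 p A)]
  (ρ₀ : ContinuousRep (GaloisGroupUnramifiedOutside K S) 𝒪 A)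

omit [IsDomain 𝒪] [TopologicalSpace 𝒪] [TopologicalSpace (PowerSeries 𝒪)] [TopologicalSpace A] [DiscreteTopology A]
  [ContinuousSMul 𝒪 A] [ContinuousSMul (PowerSeries 𝒪) (BigRepModule 𝒪 p A)] in
/-- `𝐃₁ = Maps^∞(ℤ_p, A)` is `p`-primary torsion (every smooth `p`-primary function is killed by a power of `p`,
by definition of `BigRepModule`). [cite: SkinnerUrban2014, §3.1.3 (`T ⊗ Λ^*` is `p`-primary)] -/
theorem isPrimaryTorsion_bigRepModule : IsPrimaryTorsion p (BigRepModule 𝒪 p A) := fun Φ ↦ by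
  obtain ⟨k, hk⟩ := Φ.exists_torsion
  exact ⟨k, BigRepModule.ext fun x ↦ by rw [BigRepModule.nsmul_apply, hk, BigRepModule.zero_apply]⟩

omit [IsDomain 𝒪] [TopologicalSpace 𝒪] [TopologicalSpace (PowerSeries 𝒪)] [TopologicalSpace A] [DiscreteTopology A]
  [ContinuousSMul 𝒪 A] [ContinuousSMul (PowerSeries 𝒪) (BigRepModule 𝒪 p A)] in
/-- The same in the `ℤ`-form of the Greenberg facts' clause `∀ d, ∃ n, (p ^ n : ℤ) • d = 0`.
[cite: SkinnerUrban2014, §3.1.3] -/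
theorem exists_zpow_smul_eq_zero_bigRepModule (Φ : BigRepModule 𝒪 p A) : ∃ n : ℕ, (p ^ n : ℤ) • Φ = 0 := by
  obtain ⟨k, hk⟩ := isPrimaryTorsion_bigRepModule (𝒪 := 𝒪) (p := p) (A := A) Φ
  exact ⟨k, by rw [← Nat.cast_pow, natCast_zsmul, hk]⟩

omit [ContinuousSMul 𝒪 A] in
/-- **`Hⁿ(K_Σ/K, 𝐃₁) = 0` from `corank_Λ Hⁿ(K_Σ/K, 𝐃₁) = 0`** on the anticyclotomic line (`K`-side): `cd_p(G_{K,Σ}) ≤ n`,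
`𝐃₁ = bigRep κ̄ ρ₀` cofree over the domain `Λ = 𝒪⟦T⟧`, `Hⁿ(K_Σ/K, 𝐃₁)` cofinitely generated of corank `0`.
(`…WeakLeopoldtDescentAlgebra.subsingleton_H_of_hasCorank_zero_of_isCofree` at `Γ = G_{K,Σ}`.)
[cite: Greenberg2006, §3 A (Props. 3.2–3.6, pp. 358–360), §4 A Prop. 4.1] [cite: Greenberg2016Selmer, §2.2 p. 6 L22–35] -/
theorem subsingleton_H_bigRep_of_hasCorank_zero {n : ℕ} (hcd : GroupCdLE (GaloisGroupUnramifiedOutside K S) p n)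
    (hcf : IsCofree (PowerSeries 𝒪) (BigRepModule 𝒪 p A))
    (hfg : IsCofinitelyGenerated (PowerSeries 𝒪) ((bigRep (κ.liftUnramifiedOutside S hS) ρ₀).H n))
    (h0 : HasCorank (PowerSeries 𝒪) ((bigRep (κ.liftUnramifiedOutside S hS) ρ₀).H n) 0) :
    Subsingleton ((bigRep (κ.liftUnramifiedOutside S hS) ρ₀).H n) :=
  subsingleton_H_of_hasCorank_zero_of_isCofree _ hcd isPrimaryTorsion_bigRepModule hcf hfg h0

/-- **WEAK LEOPOLDT ABOVE `K_∞` FROM CORANK `0`: `Hⁿ(Gal(K_Σ/K_∞), A) = 0`** — for a number field `K`, `S ⊇ {v ∣ p}`,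
a `ℤ_p`-extension `κ` (`K_∞ = K̄^{ker κ}`), a discrete `p`-primary `𝒪`-module `A` with a continuous `𝒪`-linear
`G_{K,S}`-action `ρ₀`: if `cd_p(G_{K,S}) ≤ n`, `𝐃₁ = bigRep κ̄ ρ₀` is cofree over `Λ = 𝒪⟦T⟧` (a domain) and
`Hⁿ(K_Σ/K, 𝐃₁)` is cofinitely generated of corank `0`, then `Hⁿ(galoisGroupAbove S (ker κ), A) = 0`
(`K`-side vanishing + the one-variable Shapiro isomorphism of `…AcTwistDeformationShapiroH`).
[cite: Greenberg2006, Thm. 3 p. 342; §3 A pp. 358–360; §4 A Prop. 4.1] [cite: Greenberg2016Selmer, §2.2–2.3 pp. 6–7] -/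
theorem subsingleton_H_above_of_hasCorank_zero {n : ℕ} (hcd : GroupCdLE (GaloisGroupUnramifiedOutside K S) p n)
    (hA : ∀ a : A, ∃ m : ℕ, (p ^ m : ℤ) • a = 0)
    (hcf : IsCofree (PowerSeries 𝒪) (BigRepModule 𝒪 p A))
    (hfg : IsCofinitelyGenerated (PowerSeries 𝒪) ((bigRep (κ.liftUnramifiedOutside S hS) ρ₀).H n))
    (h0 : HasCorank (PowerSeries 𝒪) ((bigRep (κ.liftUnramifiedOutside S hS) ρ₀).H n) 0) :
    Subsingleton ((ρ₀.restrict (galoisGroupAboveSubtype S κ.kerSubgroup)).H n) :=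
  subsingleton_H_above_of_subsingleton_H_bigRep S hS κ ρ₀ hA n
    (subsingleton_H_bigRep_of_hasCorank_zero S hS κ ρ₀ hcd hcf hfg h0)

end Generic

/-! ## §2 The same with `cd_p(G_{K,Σ}) ≤ 2` and Prop. 3.2 discharged from the PUBLISHED named facts (`Λ = ℤ_p⟦T⟧`) -/

/-- `∃ k, p ^ k • a = 0` in the `ℕ`-form gives the `ℤ`-form. [folklore] -/
theorem exists_zpow_smul_eq_zero_of_nat {A : Type*} [AddCommGroup A] {p : ℕ} {a : A} (h : ∃ k : ℕ, p ^ k • a = 0) :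
    ∃ m : ℕ, (p ^ m : ℤ) • a = 0 := by
  obtain ⟨k, hk⟩ := h
  exact ⟨k, by rw [← Nat.cast_pow, natCast_zsmul, hk]⟩

section Facts

variable {K : Type} [Field K] [NumberField K] (S : Set (HeightOneSpectrum (𝓞 K))) {p : ℕ} [Fact p.Prime]
  (hS : ∀ v : HeightOneSpectrum (𝓞 K), ((p : ℕ) : 𝓞 K) ∈ v.asIdeal → v ∈ S)
  (κ : ZpExtension K p)
  [TopologicalSpace (PowerSeries ℤ_[p])] [IsTopologicalRing (PowerSeries ℤ_[p])]
  {A : Type} [AddCommGroup A] [Module ℤ_[p] A] [TopologicalSpace A] [DiscreteTopology A] [ContinuousSMul ℤ_[p] A]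
  [ContinuousSMul (PowerSeries ℤ_[p]) (BigRepModule ℤ_[p] p A)]
  (ρ₀ : ContinuousRep (GaloisGroupUnramifiedOutside K S) ℤ_[p] A)

omit [TopologicalSpace (PowerSeries ℤ_[p])] [IsTopologicalRing (PowerSeries ℤ_[p])] in
include hS in
/-- `cd_p(G_{K,S}) ≤ 2` for `p ≠ 2` and `S ⊇ {v ∣ p}`, read off the PUB fact (Harari Cor. 17.14 / NSW (8.3.18)).
[cite: Harari2020, Cor. 17.14 (p. 295)] [cite: NeukirchSchmidtWingberg2008, (8.3.18)] -/
theorem groupCdLE_two_of_fact (hCD2 : groupCdLE_two_galoisGroupUnramifiedOutside K) (hp2 : p ≠ 2) :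
    GroupCdLE (GaloisGroupUnramifiedOutside K S) p 2 :=
  hCD2 S p hS fun _ ↦ hp2

omit [ContinuousSMul ℤ_[p] A] in
/-- `H^i(K_Σ/K, 𝐃₁)` is cofinitely generated over `Λ = ℤ_p⟦T⟧` for a cofree `𝐃₁`, read off Greenberg 2006 Prop. 3.2
(PUB fact `prop32_cohomology_isCofinitelyGenerated`, global clause). [cite: Greenberg2006, Prop. 3.2 (p. 358)] -/
theorem isCofinitelyGenerated_H_bigRep_of_fact (h32 : prop32_cohomology_isCofinitelyGenerated) (hSf : S.Finite)
    (hcf : IsCofree (PowerSeries ℤ_[p]) (BigRepModule ℤ_[p] p A)) (i : ℕ) :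
    IsCofinitelyGenerated (PowerSeries ℤ_[p]) ((bigRep (κ.liftUnramifiedOutside S hS) ρ₀).H i) :=
  prop32_cohomology_isCofinitelyGenerated.global h32 hSf hS
    (AcTwistDeformation.nonempty_iwasawaAlgebra_ringEquiv_mvPowerSeries p) (bigRep (κ.liftUnramifiedOutside S hS) ρ₀)
    exists_zpow_smul_eq_zero_bigRepModule (IsCofree.isCofinitelyGenerated hcf) i

omit [ContinuousSMul ℤ_[p] A] in
/-- **`H²(K_Σ/K, 𝐃₁) = 0` from `corank_Λ H²(K_Σ/K, 𝐃₁) = 0`, MODULO the two PUB facts** (`cd_p(G_{K,Σ}) ≤ 2`, Prop. 3.2):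
`p ≠ 2`, `S ⊇ {v ∣ p}` finite, `𝐃₁ = bigRep κ̄ ρ₀` cofree over `ℤ_p⟦T⟧`. This is "LEO-grade vanishing" on the
anticyclotomic line, where `H²` need not vanish a priori (LEAD verdict v3.1 §3 (iii)); the corank input is LEAD g2's
squeeze. [cite: Greenberg2006, §3 A pp. 358–360, §4 A Prop. 4.1] [cite: Greenberg2016Selmer, §2.2–2.3 pp. 6–7]
[cite: NeukirchSchmidtWingberg2008, (8.3.18)] -/
theorem subsingleton_H_two_bigRep_of_facts (hCD2 : groupCdLE_two_galoisGroupUnramifiedOutside K)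
    (h32 : prop32_cohomology_isCofinitelyGenerated) (hp2 : p ≠ 2) (hSf : S.Finite)
    (hcf : IsCofree (PowerSeries ℤ_[p]) (BigRepModule ℤ_[p] p A))
    (h0 : HasCorank (PowerSeries ℤ_[p]) ((bigRep (κ.liftUnramifiedOutside S hS) ρ₀).H 2) 0) :
    Subsingleton ((bigRep (κ.liftUnramifiedOutside S hS) ρ₀).H 2) :=
  subsingleton_H_bigRep_of_hasCorank_zero S hS κ ρ₀ (groupCdLE_two_of_fact S hS hCD2 hp2) hcf
    (isCofinitelyGenerated_H_bigRep_of_fact S hS κ ρ₀ h32 hSf hcf 2) h0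

/-- **WL above `K_∞` MODULO the two PUB facts: `H²(Gal(K_Σ/K_∞), A) = 0`** — `p ≠ 2`, `S ⊇ {v ∣ p}` finite, `A`
`p`-primary, `𝐃₁ = bigRep κ̄ ρ₀` cofree over `ℤ_p⟦T⟧` with `corank H²(K_Σ/K, 𝐃₁) = 0`. THE V21 INPUT WL_A in the
`galoisGroupAbove` currency. [cite: Greenberg2006, Thm. 3 p. 342; §3 A pp. 358–360; §4 A Prop. 4.1]
[cite: Greenberg2016Selmer, §2.2–2.3 pp. 6–7] [cite: NeukirchSchmidtWingberg2008, (8.3.18)] -/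
theorem subsingleton_H_two_above_of_facts (hCD2 : groupCdLE_two_galoisGroupUnramifiedOutside K)
    (h32 : prop32_cohomology_isCofinitelyGenerated) (hp2 : p ≠ 2) (hSf : S.Finite)
    (hA : ∀ a : A, ∃ m : ℕ, (p ^ m : ℤ) • a = 0)
    (hcf : IsCofree (PowerSeries ℤ_[p]) (BigRepModule ℤ_[p] p A))
    (h0 : HasCorank (PowerSeries ℤ_[p]) ((bigRep (κ.liftUnramifiedOutside S hS) ρ₀).H 2) 0) :
    Subsingleton ((ρ₀.restrict (galoisGroupAboveSubtype S κ.kerSubgroup)).H 2) :=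
  subsingleton_H_above_of_subsingleton_H_bigRep S hS κ ρ₀ hA 2
    (subsingleton_H_two_bigRep_of_facts S hS κ ρ₀ hCD2 h32 hp2 hSf hcf h0)

/-! ## §3 The two coefficient shapes of crux 2: characters (corank one) and `E[p^∞]` (`(ℚ_p/ℤ_p)ⁿ`, `n = 2`) -/

/-- **WL above `K_∞` for a CHARACTER-type coefficient module** (`A` `p`-primary of Pontryagin corank ONE:
`ℤ_p ≅ Hom(A, ℚ/ℤ)` through `jQ`, e.g. `A = ℚ_p/ℤ_p(θ) ≅ (F/𝒪)(θ)`), MODULO the two PUB facts and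
`corank H²(K_Σ/K, 𝐃₁) = 0` (LEAD g2 `hasCorank_H1_one_and_H2_zero`): cofreeness of `𝐃₁` is LEAD g2's
`AcTwistDeformation.isCofree_bigRepModule`. For `θ ∈ {θsub, θquot}` of the residual pair this is WL_ω / WL_1 of the V21
road. [cite: Greenberg2006, Thm. 3 p. 342, §4 A Prop. 4.1] [cite: Greenberg2016Selmer, §2.3 p. 7 L7–17]
[cite: PollackWeston2011, proof of Prop. A.2] -/
theorem subsingleton_H_two_above_of_corank_one (hCD2 : groupCdLE_two_galoisGroupUnramifiedOutside K)
    (h32 : prop32_cohomology_isCofinitelyGenerated) (hp2 : p ≠ 2) (hSf : S.Finite)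
    (hA : ∀ a : A, ∃ k : ℕ, p ^ k • a = 0) (jQ : A →+ AddCircle (1 : ℚ))
    (hinj : ∀ c : ℤ_[p], (∀ a : A, jQ (c • a) = 0) → c = 0)
    (hsurj : ∀ φ : A →+ AddCircle (1 : ℚ), ∃ c : ℤ_[p], ∀ a : A, φ a = jQ (c • a))
    (h0 : HasCorank (PowerSeries ℤ_[p]) ((bigRep (κ.liftUnramifiedOutside S hS) ρ₀).H 2) 0) :
    Subsingleton ((ρ₀.restrict (galoisGroupAboveSubtype S κ.kerSubgroup)).H 2) :=
  subsingleton_H_two_above_of_facts S hS κ ρ₀ hCD2 h32 hp2 hSf (fun a ↦ exists_zpow_smul_eq_zero_of_nat (hA a))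
    (AcTwistDeformation.isCofree_bigRepModule hA jQ hinj hsurj) h0

/-- **WL above `K_∞` for `A ≃ₗ[ℤ_p] (ℚ_p/ℤ_p)ⁿ`** (e.g. `A = E[p^∞]`, `n = 2`, through a basis of `T_pE`), MODULO the two
PUB facts and `corank H²(K_Σ/K, 𝐃₁) = 0` (w3 g3's rank-`n` squeeze): cofreeness of `𝐃₁` is w3 g3's
`AcTwistDeformation.isCofree_bigRepModule_pi` on the dual basis `exists_pi_character_hinj_hsurj_of_linearEquiv`. This is
WL_f of the V21 road. [cite: Greenberg2006, Thm. 3 p. 342, §4 A Prop. 4.1] [cite: Greenberg2016Selmer, §2.3 p. 7 L7–17] -/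
theorem subsingleton_H_two_above_of_linearEquiv_pi {n : ℕ} (hCD2 : groupCdLE_two_galoisGroupUnramifiedOutside K)
    (h32 : prop32_cohomology_isCofinitelyGenerated) (hp2 : p ≠ 2) (hSf : S.Finite)
    (e : A ≃ₗ[ℤ_[p]] (Fin n → QpModZp p))
    (h0 : HasCorank (PowerSeries ℤ_[p]) ((bigRep (κ.liftUnramifiedOutside S hS) ρ₀).H 2) 0) :
    Subsingleton ((ρ₀.restrict (galoisGroupAboveSubtype S κ.kerSubgroup)).H 2) := by
  obtain ⟨hA, jQ, hinj, hsurj⟩ := AcTwistDeformation.exists_pi_character_hinj_hsurj_of_linearEquiv e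
  exact subsingleton_H_two_above_of_facts S hS κ ρ₀ hCD2 h32 hp2 hSf
    (fun a ↦ exists_zpow_smul_eq_zero_of_nat (hA a)) (AcTwistDeformation.isCofree_bigRepModule_pi hA jQ hinj hsurj) h0

end Facts

/-! ## §4 Currency bridge: the vanishing above `K_∞` does not depend on the model of the coefficient module -/

section Bridge

variable {G H : Type} [Group G] [TopologicalSpace G] [Group H] [TopologicalSpace H] [IsTopologicalGroup H]
  {R₁ : Type} [CommRing R₁] [TopologicalSpace R₁] {R₂ : Type} [CommRing R₂] [TopologicalSpace R₂]
  {M₁ : Type} [AddCommGroup M₁] [Module R₁ M₁] [TopologicalSpace M₁] [IsTopologicalAddGroup M₁] [ContinuousSMul R₁ M₁]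
  {M₂ : Type} [AddCommGroup M₂] [Module R₂ M₂] [TopologicalSpace M₂] [IsTopologicalAddGroup M₂] [ContinuousSMul R₂ M₂]

/-- **`Hⁿ(H, M₁) ≃+ Hⁿ(H, M₂)` for the restrictions along `φ : H →ₜ* G`** of two continuous `G`-representations (over two
coefficient rings) identified by a `G`-equivariant continuous additive equivalence `η : M₁ ≃ₜ+ M₂` — e.g. the consumer's
own model of `E[p^∞]` / `(F/𝒪)(θ)` as a `G_{K,S}`-module versus the `ρ₀` of this file, both restricted to
`Gal(K_Σ/K_∞)` (`ContinuousRep.HAddEquivOfContinuousAddEquiv` on the restricted representations).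
[cite: Brown1982CohomologyGroups, III.1 Example 3] [cite: SerreGaloisCohomology1997, I §2.2] -/
theorem nonempty_H_restrict_addEquiv_of_continuousAddEquiv (ρ₁ : ContinuousRep G R₁ M₁) (ρ₂ : ContinuousRep G R₂ M₂)
    (η : M₁ ≃ₜ+ M₂) (hη : ∀ (g : G) (x : M₁), η (ρ₁ g x) = ρ₂ g (η x)) (φ : H →ₜ* G) (n : ℕ) :
    Nonempty ((ρ₁.restrict φ).H n ≃+ (ρ₂.restrict φ).H n) :=
  ⟨ContinuousRep.HAddEquivOfContinuousAddEquiv (ρ₁.restrict φ) (ρ₂.restrict φ) η (fun h x ↦ hη (φ h) x) n⟩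

/-- Vanishing form of the bridge: `Hⁿ(H, M₁|_φ) = 0 ↔ Hⁿ(H, M₂|_φ) = 0`.
[cite: Brown1982CohomologyGroups, III.1 Example 3] -/
theorem subsingleton_H_restrict_iff_of_continuousAddEquiv (ρ₁ : ContinuousRep G R₁ M₁) (ρ₂ : ContinuousRep G R₂ M₂)
    (η : M₁ ≃ₜ+ M₂) (hη : ∀ (g : G) (x : M₁), η (ρ₁ g x) = ρ₂ g (η x)) (φ : H →ₜ* G) (n : ℕ) :
    Subsingleton ((ρ₁.restrict φ).H n) ↔ Subsingleton ((ρ₂.restrict φ).H n) := by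
  obtain ⟨e⟩ := nonempty_H_restrict_addEquiv_of_continuousAddEquiv ρ₁ ρ₂ η hη φ n
  exact ⟨fun _ ↦ e.symm.toEquiv.subsingleton, fun _ ↦ e.toEquiv.subsingleton⟩

end Bridge

end Summit.BirchSwinnertonDyer.BirchSwinnertonDyer.Theorems.WeakLeopoldtAbove

end
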